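import Literature.Algebra.Module.SocleCosocle
import HarnessLib

/-!
# Crux C1 `MainConjectureTransportAlignedAtTwo` (stmt-BirchSwinnertonDyer-22296), line `birth`, residual (R2) `stub_lamLawKilford` (Kilford stratum):
# COPY ↔ KERNEL, the pure algebra — under a self-adjoint PERFECT pairing the `I`-torsion `M[I]` and a saturated `K ⊇ I•M` of the right rank
# are ANNIHILATORS of each other modulo `ℓ` (width seat att-p3 g16; `--supports 22296`)

THEOREMS ONLY (no `def`, no `sorry`, no named fact); pure commutative algebra, kernel-checked. Consumer: the sibling file
`…KilfordCopyKernel.lean`, which instantiates `M = H₁(X₀(N);ℤ)` (`periodHomologyHecke N`), `B` = the Hecke-self-adjoint perfect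
pairing IP (`periodHomology_exists_heckeSelfAdjoint_perfectPairing`, a tree theorem), `I = I_f` the Hecke annihilator of the newform of a
modular parametrisation datum `D`, `K = ker (x ↦ x(f))`, `ℓ = 2`: then `M[I] mod 2` is the cell's `F1Sign2.twoTorsionCopy f` and
`K + 2M` is the half-class kernel `{x ∈ Λ | D.jacobiMap [x/2] = 0}`, and the theorem below reads «`[x/2] ⊥ copy ⟺ D.jacobiMap [x/2] = 0`»
(the Weil/intersection-pairing adjunction `ker π_* = (im π^*)^⊥` on `J₀(N)[2]`). BSD is not proved by this; C1 is not closed by this.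

SETTING. `R` a commutative ring acting on a finitely generated free `ℤ`-module `M`; `B : M × M → ℤ` PERFECT (`x ↦ B(x, ·)` bijective onto
`Hom(M, ℤ)`) and `R`-SELF-ADJOINT; `I ⊴ R`; `T ≤ M` the `I`-torsion (`x ∈ T ↔ I x = 0`, as a `ℤ`-submodule); `K ≤ M` a SATURATED
`ℤ`-submodule containing `I • M`.

RESULTS.
* §1 (no rank hypothesis) `smul_eq_zero_of_forall_apply_eq_zero`: an `x` with `B(x, K) = 0` is `I`-torsion; `apply_smul_eq_zero`:
  `B(T, I•M) = 0`; `exists_forall_apply_mkQ_eq`: every functional on `M/K` is `B(x, ·)` for an `x` with `B(x, K) = 0`;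
  `exists_eq_smul_of_forall_dual_dvd`: in a free `ℤ`-module an element on which every functional is divisible by `ℓ` lies in `ℓM`;
  **`exists_mem_add_smul_of_forall_dvd`**: if `B(x, y) ∈ ℓℤ` for every `x ∈ T` then `y ∈ K + ℓM` — the inclusion `T^⊥ ⊆ K + ℓM` is FREE.
* §2 (rank hypothesis `finrank_ℤ T ≤ finrank_ℤ (M/K)`) **`forall_apply_eq_zero_of_finrank_le`**: `B(T, K) = 0` (via `B`, `T` contains the
  annihilator `A` of `K`, `A ≅ (M/K)^∨` has the rank of `M/K`, `A` is saturated, so `T/A` is torsion AND torsion-free);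
  **`mem_add_smul_iff_forall_dvd`**: `y ∈ K + ℓM ⟺ ∀ x ∈ T, ℓ ∣ B(x, y)`.
* §3 `le_finrank_quotient_of_surjective`: a surjection `M/K ↠ X` onto a group killed by `ℓ` forces `#X ≤ ℓ ^ finrank_ℤ (M/K)` (Mathlib's `ModN`),
  the source of the rank of `M/K` in the application (`#E[2] = 4`).

References (for the reading, not used in the proofs): H. Darmon, F. Diamond, R. Taylor, Fermat's Last Theorem (1995) §1.6 Lemma 1.38, §1.7
[DarmonDiamondTaylor1995]; J. E. Cremona, Algorithms for modular elliptic curves (1997) §2.8 [CremonaAlgorithms1997].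
-/

set_option autoImplicit false

noncomputable section

-- justification: the `Summit.BirchSwinnertonDyer.BirchSwinnertonDyer.…` path repeats a component (route-file convention)
set_option linter.dupNamespace false

open Module Function

namespace Summit.BirchSwinnertonDyer.BirchSwinnertonDyer.Theorems.AlignedTransportAtTwoKilfordCopyKernelAlgebra

variable {R M : Type*} [CommRing R] [AddCommGroup M] [Module R M]

/-! ## §1 No rank hypothesis -/

section NoRank

/-- An element whose functional `B(x, ·)` kills a subgroup `K ⊇ I • M` is `I`-torsion (`B` injective and `R`-self-adjoint:
`B(t x, y) = B(x, t y) = 0`). [folklore] -/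
theorem smul_eq_zero_of_forall_apply_eq_zero (B : M →+ M →+ ℤ) (hB : Injective B)
    (hadj : ∀ (t : R) (x y : M), B (t • x) y = B x (t • y))
    {I : Ideal R} {K : Submodule ℤ M} (hIK : ∀ t ∈ I, ∀ y : M, t • y ∈ K)
    {x : M} (hx : ∀ k ∈ K, B x k = 0) {t : R} (ht : t ∈ I) : t • x = 0 := by
  apply hB
  ext y
  rw [hadj, map_zero, AddMonoidHom.zero_apply]
  exact hx _ (hIK t ht y)

/-- `B(T, I • M) = 0`: an `I`-torsion element pairs to zero with every `t y`, `t ∈ I` (self-adjointness). [folklore] -/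
theorem apply_smul_eq_zero (B : M →+ M →+ ℤ) (hadj : ∀ (t : R) (x y : M), B (t • x) y = B x (t • y))
    {I : Ideal R} {x : M} (hx : ∀ t ∈ I, t • x = 0) {t : R} (ht : t ∈ I) (y : M) : B x (t • y) = 0 := by
  rw [← hadj, hx t ht, map_zero, AddMonoidHom.zero_apply]

/-- Every `ℤ`-valued functional on `M/K` is `B(x, ·)` for some `x` whose functional kills `K` (`B` surjective). [folklore] -/
theorem exists_forall_apply_mkQ_eq (B : M →+ M →+ ℤ) (hB : Surjective B) (K : Submodule ℤ M)
    (ψ : Module.Dual ℤ (M ⧸ K)) : ∃ x : M, (∀ k ∈ K, B x k = 0) ∧ ∀ m : M, B x m = ψ (K.mkQ m) := by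
  obtain ⟨x, hx⟩ := hB (ψ.toAddMonoidHom.comp K.mkQ.toAddMonoidHom)
  refine ⟨x, fun k hk ↦ ?_, fun m ↦ ?_⟩
  · rw [hx]
    change ψ (K.mkQ k) = 0
    rw [Submodule.mkQ_apply, (Submodule.Quotient.mk_eq_zero K).mpr hk, map_zero]
  · rw [hx]; rfl

/-- In a free `ℤ`-module, an element on which EVERY functional takes a value divisible by `ℓ` lies in `ℓQ` (coordinates in a basis).
[folklore] -/
theorem exists_eq_smul_of_forall_dual_dvd {Q : Type*} [AddCommGroup Q] [Module.Free ℤ Q] (ℓ : ℤ) (q : Q)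
    (h : ∀ ψ : Module.Dual ℤ Q, ℓ ∣ ψ q) : ∃ z : Q, q = ℓ • z := by
  classical
  let b := Module.Free.chooseBasis ℤ Q
  -- every coordinate of `q` is divisible by `ℓ`
  have hc : ∀ i, ℓ ∣ b.repr q i := fun i ↦ h (b.coord i)
  -- the element with coordinates `(b.repr q i) / ℓ`
  let γ : Module.Free.ChooseBasisIndex ℤ Q →₀ ℤ := Finsupp.mapRange (fun r ↦ r / ℓ) (by simp) (b.repr q)
  refine ⟨b.repr.symm γ, ?_⟩
  apply b.repr.injective
  rw [map_zsmul, LinearEquiv.apply_symm_apply]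
  ext i
  rw [Finsupp.smul_apply, smul_eq_mul, Finsupp.mapRange_apply]
  exact (Int.mul_ediv_cancel' (hc i)).symm

/-- **`T^⊥ ⊆ K + ℓM` (the free inclusion).** `B` perfect and self-adjoint, `I • M ≤ K`, `K` saturated (so `M/K` is free): if
`B(x, y) ∈ ℓℤ` for every `I`-torsion `x`, then `y ∈ K + ℓM`. (Every functional on `M/K` is `B(x, ·)` with `x` `I`-torsion, so every
functional is divisible by `ℓ` on `[y]`, so `[y] ∈ ℓ(M/K)`.) [folklore] -/
theorem exists_mem_add_smul_of_forall_dvd [Module.Finite ℤ M] (B : M →+ M →+ ℤ) (hB : Bijective B)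
    (hadj : ∀ (t : R) (x y : M), B (t • x) y = B x (t • y))
    {I : Ideal R} (K : Submodule ℤ M) (hIK : ∀ t ∈ I, ∀ y : M, t • y ∈ K)
    (hKsat : ∀ (n : ℤ) (y : M), n ≠ 0 → n • y ∈ K → y ∈ K)
    (ℓ : ℤ) {y : M} (hy : ∀ x : M, (∀ t ∈ I, t • x = 0) → ℓ ∣ B x y) :
    ∃ k ∈ K, ∃ z : M, y = k + ℓ • z := by
  -- `M/K` is torsion-free, hence free
  haveI : IsAddTorsionFree (M ⧸ K) := by
    rw [isAddTorsionFree_iff]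
    intro n hn q₁ q₂ h
    obtain ⟨m₁, rfl⟩ := K.mkQ_surjective q₁
    obtain ⟨m₂, rfl⟩ := K.mkQ_surjective q₂
    have h' : K.mkQ (n • (m₁ - m₂)) = 0 := by
      rw [map_nsmul, map_sub, nsmul_sub, sub_eq_zero]; exact h
    rw [Submodule.mkQ_apply, Submodule.Quotient.mk_eq_zero, ← Nat.cast_smul_eq_nsmul ℤ] at h'
    exact (Submodule.Quotient.eq K).mpr (hKsat n (m₁ - m₂) (Int.natCast_ne_zero.mpr hn) h')
  haveI : Module.Finite ℤ (M ⧸ K) := Module.Finite.quotient ℤ K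
  haveI : Module.Free ℤ (M ⧸ K) := Module.free_of_finite_type_torsion_free'
  have hdvd : ∀ ψ : Module.Dual ℤ (M ⧸ K), ℓ ∣ ψ (K.mkQ y) := by
    intro ψ
    obtain ⟨x, hxK, hx⟩ := exists_forall_apply_mkQ_eq B hB.2 K ψ
    rw [← hx y]
    exact hy x fun t ht ↦ smul_eq_zero_of_forall_apply_eq_zero B hB.1 hadj hIK hxK ht
  obtain ⟨z, hz⟩ := exists_eq_smul_of_forall_dual_dvd ℓ (K.mkQ y) hdvd
  obtain ⟨w, rfl⟩ := K.mkQ_surjective z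
  refine ⟨y - ℓ • w, ?_, w, by abel⟩
  rw [← Submodule.Quotient.mk_eq_zero, ← Submodule.mkQ_apply, map_sub, map_zsmul, hz, sub_self]

end NoRank

/-! ## §2 Under the rank hypothesis `finrank T ≤ finrank (M/K)` -/

section Rank

/-- **`B(T, K) = 0` from the rank count.** `B` perfect and `R`-self-adjoint on the finitely generated free `ℤ`-module `M`, `I • M ≤ K`,
`K` saturated, `T` the `I`-torsion with `finrank_ℤ T ≤ finrank_ℤ (M/K)`. Then every `I`-torsion `x` pairs to zero with `K`. (The
annihilator `A = {x | B(x, K) = 0}` lies in `T` (§1) and is `B`-isomorphic to `(M/K)^∨`, of rank `finrank (M/K) ≥ finrank T`; `A` is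
saturated, so `T/A` is torsion and torsion-free, i.e. `A = T`.) [folklore] -/
theorem forall_apply_eq_zero_of_finrank_le [Module.Finite ℤ M] [Module.Free ℤ M] (B : M →+ M →+ ℤ) (hB : Bijective B)
    (hadj : ∀ (t : R) (x y : M), B (t • x) y = B x (t • y))
    {I : Ideal R} (T : Submodule ℤ M) (hT : ∀ x, x ∈ T ↔ ∀ t ∈ I, t • x = 0)
    (K : Submodule ℤ M) (hIK : ∀ t ∈ I, ∀ y : M, t • y ∈ K)
    (hKsat : ∀ (n : ℤ) (y : M), n ≠ 0 → n • y ∈ K → y ∈ K)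
    (hrank : Module.finrank ℤ T ≤ Module.finrank ℤ (M ⧸ K)) :
    ∀ x ∈ T, ∀ k ∈ K, B x k = 0 := by
  classical
  -- `M/K` is torsion-free, hence free of finite rank
  haveI : IsAddTorsionFree (M ⧸ K) := by
    rw [isAddTorsionFree_iff]
    intro n hn q₁ q₂ h
    obtain ⟨m₁, rfl⟩ := K.mkQ_surjective q₁
    obtain ⟨m₂, rfl⟩ := K.mkQ_surjective q₂
    have h' : K.mkQ (n • (m₁ - m₂)) = 0 := by
      rw [map_nsmul, map_sub, nsmul_sub, sub_eq_zero]; exact h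
    rw [Submodule.mkQ_apply, Submodule.Quotient.mk_eq_zero, ← Nat.cast_smul_eq_nsmul ℤ] at h'
    exact (Submodule.Quotient.eq K).mpr (hKsat n (m₁ - m₂) (Int.natCast_ne_zero.mpr hn) h')
  haveI : Module.Finite ℤ (M ⧸ K) := Module.Finite.quotient ℤ K
  haveI : Module.Free ℤ (M ⧸ K) := Module.free_of_finite_type_torsion_free'
  -- the annihilator `A` of `K` under `B`, a `ℤ`-submodule of `M`
  let A : Submodule ℤ M :=
    { carrier := {x | ∀ k ∈ K, B x k = 0}
      zero_mem' := fun k _ ↦ by rw [map_zero, AddMonoidHom.zero_apply]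
      add_mem' := fun {a b} ha hb k hk ↦ by rw [map_add, AddMonoidHom.add_apply, ha k hk, hb k hk, add_zero]
      smul_mem' := fun n a ha k hk ↦ by rw [map_zsmul, AddMonoidHom.zsmul_apply, ha k hk, smul_zero] }
  have hA_mem : ∀ x, x ∈ A ↔ ∀ k ∈ K, B x k = 0 := fun x ↦ Iff.rfl
  -- §1: `A ≤ T`
  have hAT : A ≤ T := fun x hx ↦ (hT x).mpr fun t ht ↦ smul_eq_zero_of_forall_apply_eq_zero B hB.1 hadj hIK hx ht
  -- `A` is saturated
  have hAsat : ∀ (n : ℤ) (x : M), n ≠ 0 → n • x ∈ A → x ∈ A := by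
    intro n x hn hnx k hk
    have h := hnx k hk
    rw [map_zsmul, AddMonoidHom.zsmul_apply, smul_eq_mul] at h
    exact (mul_eq_zero.mp h).resolve_left hn
  -- `A ≅ (M/K)^∨` through `B`: the linear map `x ↦ (B x descended to M/K)`
  let L : (M →+ ℤ) ≃ₗ[ℤ] (M →ₗ[ℤ] ℤ) := addMonoidHomLequivInt ℤ
  have hdesc : ∀ x : A, K ≤ LinearMap.ker (L (B x)) := fun x k hk ↦ by
    rw [LinearMap.mem_ker]
    exact x.2 k hk
  let Φ : A →ₗ[ℤ] Module.Dual ℤ (M ⧸ K) :=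
    { toFun := fun x ↦ K.liftQ (L (B x)) (hdesc x)
      map_add' := fun x x' ↦ by
        apply LinearMap.ext
        intro q
        obtain ⟨m, rfl⟩ := K.mkQ_surjective q
        simp only [Submodule.mkQ_apply, Submodule.liftQ_apply, LinearMap.add_apply, Submodule.coe_add, map_add]
        rfl
      map_smul' := fun n x ↦ by
        apply LinearMap.ext
        intro q
        obtain ⟨m, rfl⟩ := K.mkQ_surjective q
        simp only [Submodule.mkQ_apply, Submodule.liftQ_apply, LinearMap.smul_apply, Submodule.coe_smul, map_zsmul,
          RingHom.id_apply]
        rfl }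
  have hΦ_apply : ∀ (x : A) (m : M), Φ x (K.mkQ m) = B x m := fun x m ↦ rfl
  have hΦ_inj : Injective Φ := by
    intro x x' h
    apply Subtype.ext
    apply hB.1
    ext m
    rw [← hΦ_apply, ← hΦ_apply, h]
  have hΦ_surj : Surjective Φ := by
    intro ψ
    obtain ⟨x, hxK, hx⟩ := exists_forall_apply_mkQ_eq B hB.2 K ψ
    refine ⟨⟨x, hxK⟩, LinearMap.ext fun q ↦ ?_⟩
    obtain ⟨m, rfl⟩ := K.mkQ_surjective q
    rw [hΦ_apply]
    exact hx m
  let eΦ : A ≃ₗ[ℤ] Module.Dual ℤ (M ⧸ K) := LinearEquiv.ofBijective Φ ⟨hΦ_inj, hΦ_surj⟩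
  -- rank of `A` = rank of `M/K` ≥ rank of `T`
  have hrankA : Module.finrank ℤ A = Module.finrank ℤ (M ⧸ K) := by
    rw [eΦ.finrank_eq]
    let b := Module.Free.chooseBasis ℤ (M ⧸ K)
    rw [Module.finrank_eq_card_basis b.dualBasis, Module.finrank_eq_card_basis b]
  -- `A` as a submodule `A'` of `T`, of the same rank as `T`
  let A' : Submodule ℤ T := Submodule.comap T.subtype A
  have hA'eq : Submodule.map T.subtype A' = A := by
    rw [Submodule.map_comap_eq, Submodule.range_subtype, inf_eq_right.mpr hAT]
  have hrankA' : Module.finrank ℤ A' = Module.finrank ℤ A := by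
    rw [← Submodule.finrank_map_subtype_eq T A', hA'eq]
  have h1 : Module.finrank ℤ A' = Module.finrank ℤ T :=
    le_antisymm (Submodule.finrank_le A') (by rw [hrankA', hrankA]; exact hrank)
  haveI : Module.Finite ℤ (T ⧸ A') := Module.Finite.quotient ℤ A'
  have hq0 := Submodule.finrank_quotient_add_finrank A'
  rw [h1, add_eq_right] at hq0
  -- hence `T/A'` is torsion: every `x ∈ T` has a non-zero multiple in `A`, so lies in `A`
  intro x hx
  obtain ⟨n, hn, hnx⟩ := (Module.finrank_eq_zero_iff.mp hq0) (A'.mkQ ⟨x, hx⟩)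
  rw [← map_smul, Submodule.mkQ_apply, Submodule.Quotient.mk_eq_zero, Submodule.mem_comap] at hnx
  exact (hA_mem x).mp (hAsat n x hn hnx)

/-- **COPY ↔ KERNEL, abstract form: `y ∈ K + ℓM ⟺ ∀ x ∈ T, ℓ ∣ B(x, y)`.** Under the hypotheses of
`forall_apply_eq_zero_of_finrank_le`: the saturated `K ⊇ I • M` taken modulo `ℓ` and the `I`-torsion `T` taken modulo `ℓ` are each
other's annihilators for `B mod ℓ`. (⟹: `B(T, K) = 0` and `B(x, ℓz) ∈ ℓℤ`; ⟸: §1.) For `M = H₁(X₀(N);ℤ)`, `ℓ = 2`: the half-class kernel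
of a modular parametrisation is the orthogonal of the copy of `E[2]` in `J₀(N)[2]`. [folklore] -/
theorem mem_add_smul_iff_forall_dvd [Module.Finite ℤ M] [Module.Free ℤ M] (B : M →+ M →+ ℤ) (hB : Bijective B)
    (hadj : ∀ (t : R) (x y : M), B (t • x) y = B x (t • y))
    {I : Ideal R} (T : Submodule ℤ M) (hT : ∀ x, x ∈ T ↔ ∀ t ∈ I, t • x = 0)
    (K : Submodule ℤ M) (hIK : ∀ t ∈ I, ∀ y : M, t • y ∈ K)
    (hKsat : ∀ (n : ℤ) (y : M), n ≠ 0 → n • y ∈ K → y ∈ K)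
    (hrank : Module.finrank ℤ T ≤ Module.finrank ℤ (M ⧸ K)) (ℓ : ℤ) (y : M) :
    (∃ k ∈ K, ∃ z : M, y = k + ℓ • z) ↔ ∀ x ∈ T, ℓ ∣ B x y := by
  constructor
  · rintro ⟨k, hk, z, rfl⟩ x hx
    rw [map_add, forall_apply_eq_zero_of_finrank_le B hB hadj T hT K hIK hKsat hrank x hx k hk, zero_add, map_zsmul,
      smul_eq_mul]
    exact dvd_mul_right ℓ _
  · intro h
    exact exists_mem_add_smul_of_forall_dvd B hB hadj K hIK hKsat ℓ fun x hx ↦ h x ((hT x).mpr hx)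

end Rank

/-! ## §3 The rank of `M/K` from a finite quotient -/

section Quotient

/-- **A surjection of `M/K` onto a group killed by `ℓ` bounds `#X ≤ ℓ ^ finrank_ℤ (M/K)`** (`K` saturated, so `M/K` is free and
`#((M/K)/ℓ) = ℓ ^ rank`, Mathlib's `ModN.natCard_eq`). In the application `X = E[2]`, `#X = 4`, `ℓ = 2`, whence `finrank (M/K) ≥ 2`.
[folklore] -/
theorem natCard_le_pow_finrank_quotient [Module.Finite ℤ M] (K : Submodule ℤ M)
    (hKsat : ∀ (n : ℤ) (y : M), n ≠ 0 → n • y ∈ K → y ∈ K)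
    {X : Type*} [AddCommGroup X] (ℓ : ℕ) [NeZero ℓ] (hX : ∀ P : X, ℓ • P = 0)
    (θ : M →+ X) (hθK : ∀ k ∈ K, θ k = 0) (hθ : Surjective θ) :
    Nat.card X ≤ ℓ ^ Module.finrank ℤ (M ⧸ K) := by
  classical
  haveI : IsAddTorsionFree (M ⧸ K) := by
    rw [isAddTorsionFree_iff]
    intro n hn q₁ q₂ h
    obtain ⟨m₁, rfl⟩ := K.mkQ_surjective q₁
    obtain ⟨m₂, rfl⟩ := K.mkQ_surjective q₂
    have h' : K.mkQ (n • (m₁ - m₂)) = 0 := by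
      rw [map_nsmul, map_sub, nsmul_sub, sub_eq_zero]; exact h
    rw [Submodule.mkQ_apply, Submodule.Quotient.mk_eq_zero, ← Nat.cast_smul_eq_nsmul ℤ] at h'
    exact (Submodule.Quotient.eq K).mpr (hKsat n (m₁ - m₂) (Int.natCast_ne_zero.mpr hn) h')
  haveI : Module.Finite ℤ (M ⧸ K) := Module.Finite.quotient ℤ K
  haveI : Module.Free ℤ (M ⧸ K) := Module.free_of_finite_type_torsion_free'
  -- `θ` descends to `M/K`, then to `ModN (M/K) ℓ`
  let θ' : M ⧸ K →+ X := (K.liftQ θ.toIntLinearMap fun k hk ↦ by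
    rw [LinearMap.mem_ker, AddMonoidHom.coe_toIntLinearMap]; exact hθK k hk).toAddMonoidHom
  have hθ' : ∀ m : M, θ' (K.mkQ m) = θ m := fun m ↦ rfl
  have hθ'surj : Surjective θ' := fun P ↦ by
    obtain ⟨m, rfl⟩ := hθ P
    exact ⟨K.mkQ m, hθ' m⟩
  let θ'' : ModN (M ⧸ K) ℓ →+ X := ModN.liftEquiv.symm ⟨θ', fun q ↦ hX (θ' q)⟩
  have hθ'' : ∀ q : M ⧸ K, θ'' (ModN.mkQ ℓ q) = θ' q := fun q ↦ rfl
  have hθ''surj : Surjective θ'' := fun P ↦ by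
    obtain ⟨q, rfl⟩ := hθ'surj P
    exact ⟨ModN.mkQ ℓ q, hθ'' q⟩
  rw [← ModN.natCard_eq (M ⧸ K) ℓ]
  haveI : Finite X := Finite.of_surjective θ'' hθ''surj
  exact Nat.card_le_card_of_surjective θ'' hθ''surj

/-- **The kernel of such a surjection is `K + ℓM` when `#X = ℓ ^ finrank_ℤ (M/K)`**: `θ` factors through `(M/K)/ℓ ≅ (ℤ/ℓ)^{rank} ↠ X`, a bijection by
counting, so `θ y = 0` forces `[y] ∈ ℓ(M/K)`. In the application: the half-class kernel of a modular parametrisation is `ker ev_f + 2Λ`. [folklore] -/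
theorem exists_mem_add_smul_of_apply_eq_zero [Module.Finite ℤ M] (K : Submodule ℤ M)
    (hKsat : ∀ (n : ℤ) (y : M), n ≠ 0 → n • y ∈ K → y ∈ K)
    {X : Type*} [AddCommGroup X] (ℓ : ℕ) [NeZero ℓ] (hX : ∀ P : X, ℓ • P = 0)
    (θ : M →+ X) (hθK : ∀ k ∈ K, θ k = 0) (hθ : Surjective θ) (hcard : Nat.card X = ℓ ^ Module.finrank ℤ (M ⧸ K))
    {y : M} (hy : θ y = 0) : ∃ k ∈ K, ∃ z : M, y = k + (ℓ : ℤ) • z := by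
  classical
  haveI : IsAddTorsionFree (M ⧸ K) := by
    rw [isAddTorsionFree_iff]
    intro n hn q₁ q₂ h
    obtain ⟨m₁, rfl⟩ := K.mkQ_surjective q₁
    obtain ⟨m₂, rfl⟩ := K.mkQ_surjective q₂
    have h' : K.mkQ (n • (m₁ - m₂)) = 0 := by
      rw [map_nsmul, map_sub, nsmul_sub, sub_eq_zero]; exact h
    rw [Submodule.mkQ_apply, Submodule.Quotient.mk_eq_zero, ← Nat.cast_smul_eq_nsmul ℤ] at h'
    exact (Submodule.Quotient.eq K).mpr (hKsat n (m₁ - m₂) (Int.natCast_ne_zero.mpr hn) h')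
  haveI : Module.Finite ℤ (M ⧸ K) := Module.Finite.quotient ℤ K
  haveI : Module.Free ℤ (M ⧸ K) := Module.free_of_finite_type_torsion_free'
  -- `θ` descends to `M/K`, then to `ModN (M/K) ℓ`
  let θ' : M ⧸ K →+ X := (K.liftQ θ.toIntLinearMap fun k hk ↦ by
    rw [LinearMap.mem_ker, AddMonoidHom.coe_toIntLinearMap]; exact hθK k hk).toAddMonoidHom
  have hθ' : ∀ m : M, θ' (K.mkQ m) = θ m := fun m ↦ rfl
  have hθ'surj : Surjective θ' := fun P ↦ by
    obtain ⟨m, rfl⟩ := hθ P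
    exact ⟨K.mkQ m, hθ' m⟩
  let θ'' : ModN (M ⧸ K) ℓ →+ X := ModN.liftEquiv.symm ⟨θ', fun q ↦ hX (θ' q)⟩
  have hθ'' : ∀ q : M ⧸ K, θ'' (ModN.mkQ ℓ q) = θ' q := fun q ↦ rfl
  have hθ''surj : Surjective θ'' := fun P ↦ by
    obtain ⟨q, rfl⟩ := hθ'surj P
    exact ⟨ModN.mkQ ℓ q, hθ'' q⟩
  -- counting: `θ''` is a bijection
  haveI : Finite X := Finite.of_surjective θ'' hθ''surj
  letI : Fintype X := Fintype.ofFinite X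
  letI : Fintype (ModN (M ⧸ K) ℓ) := Fintype.ofFinite _
  have hcard' : Fintype.card (ModN (M ⧸ K) ℓ) = Fintype.card X := by
    rw [← Nat.card_eq_fintype_card, ← Nat.card_eq_fintype_card, ModN.natCard_eq, hcard]
  have hinj : Injective θ'' := ((Fintype.bijective_iff_surjective_and_card θ'').mpr ⟨hθ''surj, hcard'⟩).1
  -- conclude
  have h0 : θ'' (ModN.mkQ ℓ (K.mkQ y)) = 0 := by rw [hθ'', hθ', hy]
  have h1 : ModN.mkQ ℓ (K.mkQ y) = 0 := hinj (by rw [h0, map_zero])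
  have h2 : K.mkQ y ∈ LinearMap.range (LinearMap.lsmul ℤ (M ⧸ K) ℓ) := by
    rw [← Submodule.Quotient.mk_eq_zero]
    exact h1
  obtain ⟨q, hq⟩ := LinearMap.mem_range.mp h2
  obtain ⟨w, rfl⟩ := K.mkQ_surjective q
  rw [LinearMap.lsmul_apply, ← map_zsmul] at hq
  refine ⟨y - (ℓ : ℤ) • w, ?_, w, by abel⟩
  rw [← Submodule.Quotient.mk_eq_zero, ← Submodule.mkQ_apply, map_sub, hq, sub_self]

end Quotient

end Summit.BirchSwinnertonDyer.BirchSwinnertonDyer.Theorems.AlignedTransportAtTwoKilfordCopyKernelAlgebra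

end
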